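import Summits.QuantumFields.BalabanUV.Beta.FP.RelInvPeriodisedChart
import Summits.QuantumFields.BalabanUV.Beta.FP.RelInvPeriodisedMinOp

/-!
# `BalabanUV.Beta.FP.RelInvPeriodisedChartMinOp` — road «FP» (binder row D1), ROUTE T row **(T-INV)**, CHART-GENERIC EDITION of `RelInvPeriodisedMinOp` §2:
# **THE MIXED (FIELD × MULTIPLIER) AND FIELD × FIELD ENTRIES OF THE INVERSE OF THE COMB-SLICED PERIODISED SYSTEM, FOR ANY PERIODISABLE
# RELATIVE-INVERSE CHART** `(A, 𝕄)` at any root `ρ` — `±Â` on the live field slots, `0` on the comb slots (`Â := perF M A`)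

HONEST DEPENDENCY (page 1, mandatory): continuum YM on T⁴ ⇐ BetaPertH ∧ nine spine estimates (0/9 proved); BetaPertH ⇐ (D1) ∧ (D4) ∧
CAP+tail; G-an2-4 gates asym, D1 and NE2/3/4.  HONEST FRAMING (cell contract, verbatim): «discharging `BetaPertH` makes Bałaban's UV
stability UNCONDITIONAL — a real constructive-QFT result; it is NOT the continuum limit and NOT the Clay problem.»  ABSOLUTE RULE (cell
charter, verbatim): «No internally-minted statement may enter as a cited fact. Every hypothesis is either kernel-proved in this package or a
verbatim quotation of a PUBLISHED theorem with page reference. The manuscript(s) under audit are NOT citable for their own disputed steps — they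
are the thing under adjudication; programme-internal (2001/route/tribunal) claims are never citable.»

CONTENT (proofs = leaf-05 g26's `RelInvPeriodisedMinOp` §2 VERBATIM, the chart abstracted: `torus_sliced_kkt_of_relInv` ∕ `torus_isUnit_det_kkt_of_slots_of_relInv`
of `RelInvPeriodisedChart` in place of p309426's rooted theorems; the generic §1 of `RelInvPeriodisedMinOp` — `inv_kkt_apply_reindex`, `inv_kkt_kill_row ∕ _col` —
reused BY NAME): slot-map form (`fν` field slots, `fμ` multiplier slots, comb `cb : ρ₁ → ν`, `hlive` the `axEc ρ Lc`-live reading, `τ₁ x b := [b = cb x]`):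
**`torus_inv_kkt_of_slots_inl_inr_of_relInv`** (`K̃⁻¹ (inl b) (inr (inl a)) = if b ∈ range cb then 0 else Â (fν b) (fμ a)`),
**`torus_inv_kkt_of_slots_inr_inl_of_relInv`** (`= … else −Â (fμ a) (fν b)`), **`torus_inv_kkt_of_slots_inl_inl_of_relInv`** (the fluctuation covariance:
`K̃⁻¹ (inl b) (inl b') = if (b ∈ range cb ∨ b' ∈ range cb) then 0 else Â (fν b) (fν b')`).  The presentation of record is in the sequel `FP/RelInvPeriodisedChartMinOpRecord`.
Instances: the rooted chart (leaf-05 g26, untouched) and chart (III′) (`FP/RelInvPeriodisedComb*`).  [folklore]; no `Prop`, no `def`, nothing cited, 0 sorry;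
discharges NO binder of row D1; NOT the dictionary's `hId₁`, NOT (J-a), NOT (T-ID), NOT SDF, NOT D1, NOT BetaPertH, NOT continuum, NOT Clay; 0 estimates.
Unit `b2b-balaban-beta-d1-formalise-leaf-05` (gen 29), 2026-08-22; no existing file touched.
-/

noncomputable section

open scoped BigOperators Matrix

namespace Summit.QuantumFields.BalabanUV.Beta.FP.RelInvPeriodisedChartMinOp

open Matrix
open Literature.Probability.LatticeModels (Torus.proj)
open Literature.MathematicalPhysics.QuantumFieldTheory.Balaban1983to89
open Literature.MathematicalPhysics.QuantumFieldTheory.Balaban1983to89.Beta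
open Literature.MathematicalPhysics.QuantumFieldTheory.Balaban1983to89.Beta.Composition (kkt)
open Literature.MathematicalPhysics.QuantumFieldTheory.Balaban1983to89.Beta.CompositionSingular (effForm flucCov minOp minOpL)
open B6Lemma24Torus (pbox)
open ExpKernelCalculus (MKer shiftK)
open AffineAveraging (Site box toSite)
open OneStepResolventKernel (Fib)
open Summit.QuantumFields.BalabanUV.Beta.TameKernelCalculus (Spr)
open Summit.QuantumFields.BalabanUV.Beta.ChartConjugationRelative (RelInv)
open Summit.QuantumFields.BalabanUV.Beta.AxialDressingRooted (axEc axEc_inl_inl axEc_inr_inr IsCombBondAt)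
open Summit.QuantumFields.BalabanUV.Beta.SaddleInverse (regroup)
open Summit.QuantumFields.BalabanUV.Beta.FP.KernelPeriodisationFib (Idx perF)
open Summit.QuantumFields.BalabanUV.Beta.FP.RelInvPeriodisedChart (torus_sliced_kkt_of_relInv torus_isUnit_det_kkt_of_slots_of_relInv)
open Summit.QuantumFields.BalabanUV.Beta.FP.RelInvPeriodisedSliced (kkt_submatrix_equiv)
open Summit.QuantumFields.BalabanUV.Beta.FP.RelInvPeriodisedMinOp (inv_kkt_apply_reindex inv_kkt_kill_row inv_kkt_kill_col)

/-! ## §2 Slot-map form, any chart: the mixed live entries of the inverse of the torus sliced KKT -/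

section Slots

variable {d : ℕ} {Lc : ℕ} [NeZero Lc] (M : Fin (d + 1) → ℕ) [∀ μ, NeZero (M μ)] {A Mh : MKer (d + 1) (Fib d)}

open Classical in
/-- **[folklore] THE FIELD × MULTIPLIER ENTRIES OF THE INVERSE OF THE TORUS SLICED KKT, SLOT-MAP FORM** (ANY CHART; hypotheses of
`RelInvPeriodisedChart.torus_isUnit_det_kkt_of_slots_of_relInv` verbatim: fine bonds by `fν`, coarse multipliers by `fμ`, the comb by `cb : ρ₁ → ν`, `hlive` the
`axEc`-live reading, `τ₁ x b := [b = cb x]`): for a field slot `b` and a multiplier `a`,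
`(kkt (K̂∘(fν,fν)) [K̂∘(fμ,fν); τ₁])⁻¹ (inl b) (inr (inl a)) = if b ∈ range cb then 0 else Â (fν b) (fμ a)`,
`Â := perF M A` — `torus_sliced_kkt_of_relInv`'s live entries on field rows (`+Â`), `inv_kkt_kill_row` on comb rows. -/
theorem torus_inv_kkt_of_slots_inl_inr_of_relInv (ρ : Fin (d + 1) → ℤ) (hM : ∀ i, Lc ∣ M i) (hA : Spr A) (hMh : Spr Mh)
    (hAt : ∀ t : Fin (d + 1) → ℤ, shiftK ((Lc : ℤ) • t) A = A) (hMt : ∀ t : Fin (d + 1) → ℤ, shiftK ((Lc : ℤ) • t) Mh = Mh)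
    (hrel : RelInv A Mh (axEc ρ Lc))
    (hmm : ∀ (x y : Fin (d + 1) → ℤ) (κ l : Fin (d + 1)), Mh x y (Sum.inr κ) (Sum.inr l) = 0)
    (hanti : ∀ (x y : Fin (d + 1) → ℤ) (κ l : Fin (d + 1)), Mh x y (Sum.inl κ) (Sum.inr l) = -Mh y x (Sum.inr l) (Sum.inl κ))
    {ν μ ρ₁ : Type*} [Fintype ν] [Fintype μ] [Fintype ρ₁] [DecidableEq ν] [DecidableEq μ] [DecidableEq ρ₁]
    (fν : ν → Idx M (Fib d)) (fμ : μ → Idx M (Fib d)) (hfν : Function.Injective fν) (hfμ : Function.Injective fμ)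
    (hν : ∀ b : ν, ∃ α : Fin (d + 1), (fν b).2 = Sum.inl α) (hμ : ∀ a : μ, ∃ m : Fin (d + 1), (fμ a).2 = Sum.inr m)
    (cb : ρ₁ → ν) (hcb : Function.Injective cb)
    (hlive : ∀ p : Idx M (Fib d),
      axEc ρ Lc p.1 p.1 p.2 p.2 = 1 ↔ (∃ b, b ∉ Set.range cb ∧ fν b = p) ∨ p ∈ Set.range fμ) (b : ν) (a : μ) :
    (kkt ((perF M Mh).submatrix fν fν)
      (fromRows ((perF M Mh).submatrix fμ fν)
        (Matrix.of fun (x : ρ₁) (b : ν) => if b = cb x then (1 : ℝ) else 0)))⁻¹ (Sum.inl b) (Sum.inr (Sum.inl a))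
      = if b ∈ Set.range cb then 0 else perF M A (fν b) (fμ a) := by
  set Mp := perF M Mh with hMp
  by_cases hbc : b ∈ Set.range cb
  · -- a comb slot: the killed field row vanishes (§1)
    obtain ⟨x, rfl⟩ := hbc
    rw [if_pos ⟨x, rfl⟩]
    exact inv_kkt_kill_row _ _ cb (torus_isUnit_det_kkt_of_slots_of_relInv M ρ hM hA hMh hAt hMt hrel hmm hanti fν fμ hfν hfμ hν hμ cb hcb hlive) x _ (by simp)
  · rw [if_neg hbc]
    -- live presentation `f := fν off the comb ⊕ fμ`, dead presentation `g := fν ∘ cb` (as in p314950; the chart displayed)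
    let f : {b : ν // b ∉ Set.range cb} ⊕ μ → Idx M (Fib d) := Sum.elim (fun b => fν b) fμ
    let g : ρ₁ → Idx M (Fib d) := fun x => fν (cb x)
    have hf : Function.Injective f := by
      rintro (b₁ | a₁) (b' | a₁') h
      · exact congrArg Sum.inl (Subtype.ext (hfν h))
      · obtain ⟨α, hα⟩ := hν b₁; obtain ⟨m, hm⟩ := hμ a₁'
        have e : (fν b₁).2 = (fμ a₁').2 := congrArg Prod.snd h; rw [hα, hm] at e; exact absurd e Sum.inl_ne_inr
      · obtain ⟨α, hα⟩ := hν b'; obtain ⟨m, hm⟩ := hμ a₁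
        have e : (fμ a₁).2 = (fν b').2 := congrArg Prod.snd h; rw [hα, hm] at e; exact absurd e Sum.inr_ne_inl
      · exact congrArg Sum.inr (hfμ h)
    have hlive' : ∀ p : Idx M (Fib d), axEc ρ Lc p.1 p.1 p.2 p.2 = 1 ↔ p ∈ Set.range f := by
      intro p
      rw [hlive p]
      constructor
      · rintro (⟨b₁, hb, rfl⟩ | ⟨a₁, rfl⟩)
        exacts [⟨Sum.inl ⟨b₁, hb⟩, rfl⟩, ⟨Sum.inr a₁, rfl⟩]
      · rintro ⟨b₁ | a₁, rfl⟩
        exacts [Or.inl ⟨b₁, b₁.2, rfl⟩, Or.inr ⟨a₁, rfl⟩]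
    obtain ⟨-, hI⟩ := torus_sliced_kkt_of_relInv M ρ hM hA hMh hAt hMt hrel hmm hanti f hf hlive' (fun b => hν b) hμ g
    let eν : {b : ν // b ∉ Set.range cb} ⊕ ρ₁ ≃ ν :=
      ((Equiv.sumComm _ _).trans (Equiv.sumCongr (Equiv.ofInjective cb hcb) (Equiv.refl _))).trans (Equiv.sumCompl fun b => b ∈ Set.range cb)
    have heν_inl : ∀ b : {b : ν // b ∉ Set.range cb}, eν (Sum.inl b) = b := fun b => rfl
    have heν_inr : ∀ x : ρ₁, eν (Sum.inr x) = cb x := fun x => rfl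
    have hsys : kkt ((Mp.submatrix fν fν).submatrix eν eν)
          ((fromRows (Mp.submatrix fμ fν) (Matrix.of fun (x : ρ₁) (b : ν) => if b = cb x then (1 : ℝ) else 0)).submatrix id eν)
        = kkt (fromBlocks (Mp.submatrix (f ∘ Sum.inl) (f ∘ Sum.inl)) (Mp.submatrix (f ∘ Sum.inl) g) (Mp.submatrix g (f ∘ Sum.inl))
              (Mp.submatrix g g))
            (fromRows (fromCols (Mp.submatrix (f ∘ Sum.inr) (f ∘ Sum.inl)) (Mp.submatrix (f ∘ Sum.inr) g))
              (fromCols (0 : Matrix ρ₁ {b : ν // b ∉ Set.range cb} ℝ) (1 : Matrix ρ₁ ρ₁ ℝ))) := by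
      congr 1
      · ext (b₁ | x) (b' | x') <;> rfl
      · ext (a₁ | x) (b' | x') <;> try rfl
        · simp only [submatrix_apply, id, fromRows_apply_inr, fromCols_apply_inl, of_apply, heν_inl, Matrix.zero_apply]
          exact if_neg fun h : (b' : ν) = cb x => b'.2 ⟨x, h.symm⟩
        · simp only [submatrix_apply, id, fromRows_apply_inr, fromCols_apply_inr, of_apply, heν_inr]
          by_cases h : x = x'
          · subst h; rw [if_pos rfl, Matrix.one_apply_eq]
          · rw [if_neg fun e => h (hcb e).symm, Matrix.one_apply_ne h]
    -- the live field slot `b` is `eν (inl ⟨b, hbc⟩)`; its `kBig` index is `regroup (inl (inl ⟨b, hbc⟩)) = inl (inl ⟨b, hbc⟩)` by `rfl`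
    have hb : (Sum.inl b : ν ⊕ (μ ⊕ ρ₁)) = Sum.map eν id (Sum.inl (Sum.inl ⟨b, hbc⟩)) := rfl
    have ha : (Sum.inr (Sum.inl a) : ν ⊕ (μ ⊕ ρ₁)) = Sum.map eν id (Sum.inr (Sum.inl a)) := rfl
    rw [hb, ha, inv_kkt_apply_reindex, hsys]
    have h := hI (Sum.inl ⟨b, hbc⟩) (Sum.inr a)
    simp only [Sum.elim_inl, one_mul] at h
    exact h

open Classical in
/-- **[folklore] THE MULTIPLIER × FIELD ENTRIES** (same hypotheses):
`(kkt (K̂∘(fν,fν)) [K̂∘(fμ,fν); τ₁])⁻¹ (inr (inl a)) (inl b) = if b ∈ range cb then 0 else −Â (fμ a) (fν b)` — `torus_sliced_kkt`'s live entries on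
multiplier rows (`−Â`), `inv_kkt_kill_col` on comb columns. -/
theorem torus_inv_kkt_of_slots_inr_inl_of_relInv (ρ : Fin (d + 1) → ℤ) (hM : ∀ i, Lc ∣ M i) (hA : Spr A) (hMh : Spr Mh)
    (hAt : ∀ t : Fin (d + 1) → ℤ, shiftK ((Lc : ℤ) • t) A = A) (hMt : ∀ t : Fin (d + 1) → ℤ, shiftK ((Lc : ℤ) • t) Mh = Mh)
    (hrel : RelInv A Mh (axEc ρ Lc))
    (hmm : ∀ (x y : Fin (d + 1) → ℤ) (κ l : Fin (d + 1)), Mh x y (Sum.inr κ) (Sum.inr l) = 0)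
    (hanti : ∀ (x y : Fin (d + 1) → ℤ) (κ l : Fin (d + 1)), Mh x y (Sum.inl κ) (Sum.inr l) = -Mh y x (Sum.inr l) (Sum.inl κ))
    {ν μ ρ₁ : Type*} [Fintype ν] [Fintype μ] [Fintype ρ₁] [DecidableEq ν] [DecidableEq μ] [DecidableEq ρ₁]
    (fν : ν → Idx M (Fib d)) (fμ : μ → Idx M (Fib d)) (hfν : Function.Injective fν) (hfμ : Function.Injective fμ)
    (hν : ∀ b : ν, ∃ α : Fin (d + 1), (fν b).2 = Sum.inl α) (hμ : ∀ a : μ, ∃ m : Fin (d + 1), (fμ a).2 = Sum.inr m)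
    (cb : ρ₁ → ν) (hcb : Function.Injective cb)
    (hlive : ∀ p : Idx M (Fib d),
      axEc ρ Lc p.1 p.1 p.2 p.2 = 1 ↔ (∃ b, b ∉ Set.range cb ∧ fν b = p) ∨ p ∈ Set.range fμ) (a : μ) (b : ν) :
    (kkt ((perF M Mh).submatrix fν fν)
      (fromRows ((perF M Mh).submatrix fμ fν)
        (Matrix.of fun (x : ρ₁) (b : ν) => if b = cb x then (1 : ℝ) else 0)))⁻¹ (Sum.inr (Sum.inl a)) (Sum.inl b)
      = if b ∈ Set.range cb then 0 else -(perF M A (fμ a) (fν b)) := by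
  set Mp := perF M Mh with hMp
  by_cases hbc : b ∈ Set.range cb
  · obtain ⟨x, rfl⟩ := hbc
    rw [if_pos ⟨x, rfl⟩]
    exact inv_kkt_kill_col _ _ cb (torus_isUnit_det_kkt_of_slots_of_relInv M ρ hM hA hMh hAt hMt hrel hmm hanti fν fμ hfν hfμ hν hμ cb hcb hlive) _ x (by simp)
  · rw [if_neg hbc]
    let f : {b : ν // b ∉ Set.range cb} ⊕ μ → Idx M (Fib d) := Sum.elim (fun b => fν b) fμ
    let g : ρ₁ → Idx M (Fib d) := fun x => fν (cb x)
    have hf : Function.Injective f := by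
      rintro (b₁ | a₁) (b' | a₁') h
      · exact congrArg Sum.inl (Subtype.ext (hfν h))
      · obtain ⟨α, hα⟩ := hν b₁; obtain ⟨m, hm⟩ := hμ a₁'
        have e : (fν b₁).2 = (fμ a₁').2 := congrArg Prod.snd h; rw [hα, hm] at e; exact absurd e Sum.inl_ne_inr
      · obtain ⟨α, hα⟩ := hν b'; obtain ⟨m, hm⟩ := hμ a₁
        have e : (fμ a₁).2 = (fν b').2 := congrArg Prod.snd h; rw [hα, hm] at e; exact absurd e Sum.inr_ne_inl
      · exact congrArg Sum.inr (hfμ h)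
    have hlive' : ∀ p : Idx M (Fib d), axEc ρ Lc p.1 p.1 p.2 p.2 = 1 ↔ p ∈ Set.range f := by
      intro p
      rw [hlive p]
      constructor
      · rintro (⟨b₁, hb, rfl⟩ | ⟨a₁, rfl⟩)
        exacts [⟨Sum.inl ⟨b₁, hb⟩, rfl⟩, ⟨Sum.inr a₁, rfl⟩]
      · rintro ⟨b₁ | a₁, rfl⟩
        exacts [Or.inl ⟨b₁, b₁.2, rfl⟩, Or.inr ⟨a₁, rfl⟩]
    obtain ⟨-, hI⟩ := torus_sliced_kkt_of_relInv M ρ hM hA hMh hAt hMt hrel hmm hanti f hf hlive' (fun b => hν b) hμ g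
    let eν : {b : ν // b ∉ Set.range cb} ⊕ ρ₁ ≃ ν :=
      ((Equiv.sumComm _ _).trans (Equiv.sumCongr (Equiv.ofInjective cb hcb) (Equiv.refl _))).trans (Equiv.sumCompl fun b => b ∈ Set.range cb)
    have heν_inl : ∀ b : {b : ν // b ∉ Set.range cb}, eν (Sum.inl b) = b := fun b => rfl
    have heν_inr : ∀ x : ρ₁, eν (Sum.inr x) = cb x := fun x => rfl
    have hsys : kkt ((Mp.submatrix fν fν).submatrix eν eν)
          ((fromRows (Mp.submatrix fμ fν) (Matrix.of fun (x : ρ₁) (b : ν) => if b = cb x then (1 : ℝ) else 0)).submatrix id eν)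
        = kkt (fromBlocks (Mp.submatrix (f ∘ Sum.inl) (f ∘ Sum.inl)) (Mp.submatrix (f ∘ Sum.inl) g) (Mp.submatrix g (f ∘ Sum.inl))
              (Mp.submatrix g g))
            (fromRows (fromCols (Mp.submatrix (f ∘ Sum.inr) (f ∘ Sum.inl)) (Mp.submatrix (f ∘ Sum.inr) g))
              (fromCols (0 : Matrix ρ₁ {b : ν // b ∉ Set.range cb} ℝ) (1 : Matrix ρ₁ ρ₁ ℝ))) := by
      congr 1
      · ext (b₁ | x) (b' | x') <;> rfl
      · ext (a₁ | x) (b' | x') <;> try rfl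
        · simp only [submatrix_apply, id, fromRows_apply_inr, fromCols_apply_inl, of_apply, heν_inl, Matrix.zero_apply]
          exact if_neg fun h : (b' : ν) = cb x => b'.2 ⟨x, h.symm⟩
        · simp only [submatrix_apply, id, fromRows_apply_inr, fromCols_apply_inr, of_apply, heν_inr]
          by_cases h : x = x'
          · subst h; rw [if_pos rfl, Matrix.one_apply_eq]
          · rw [if_neg fun e => h (hcb e).symm, Matrix.one_apply_ne h]
    have hb : (Sum.inl b : ν ⊕ (μ ⊕ ρ₁)) = Sum.map eν id (Sum.inl (Sum.inl ⟨b, hbc⟩)) := rfl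
    have ha : (Sum.inr (Sum.inl a) : ν ⊕ (μ ⊕ ρ₁)) = Sum.map eν id (Sum.inr (Sum.inl a)) := rfl
    rw [hb, ha, inv_kkt_apply_reindex, hsys]
    have h := hI (Sum.inr a) (Sum.inl ⟨b, hbc⟩)
    simp only [Sum.elim_inr, neg_mul, one_mul] at h
    exact h

open Classical in
/-- **[folklore] THE FIELD × FIELD ENTRIES** (same hypotheses) — the fluctuation covariance `flucCov` in slot-map form:
`(kkt (K̂∘(fν,fν)) [K̂∘(fμ,fν); τ₁])⁻¹ (inl b) (inl b') = if (b ∈ range cb ∨ b' ∈ range cb) then 0 else Â (fν b) (fν b')` — `torus_sliced_kkt`'s live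
entries on field rows (`+Â`), the kills on comb rows AND comb columns. -/
theorem torus_inv_kkt_of_slots_inl_inl_of_relInv (ρ : Fin (d + 1) → ℤ) (hM : ∀ i, Lc ∣ M i) (hA : Spr A) (hMh : Spr Mh)
    (hAt : ∀ t : Fin (d + 1) → ℤ, shiftK ((Lc : ℤ) • t) A = A) (hMt : ∀ t : Fin (d + 1) → ℤ, shiftK ((Lc : ℤ) • t) Mh = Mh)
    (hrel : RelInv A Mh (axEc ρ Lc))
    (hmm : ∀ (x y : Fin (d + 1) → ℤ) (κ l : Fin (d + 1)), Mh x y (Sum.inr κ) (Sum.inr l) = 0)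
    (hanti : ∀ (x y : Fin (d + 1) → ℤ) (κ l : Fin (d + 1)), Mh x y (Sum.inl κ) (Sum.inr l) = -Mh y x (Sum.inr l) (Sum.inl κ))
    {ν μ ρ₁ : Type*} [Fintype ν] [Fintype μ] [Fintype ρ₁] [DecidableEq ν] [DecidableEq μ] [DecidableEq ρ₁]
    (fν : ν → Idx M (Fib d)) (fμ : μ → Idx M (Fib d)) (hfν : Function.Injective fν) (hfμ : Function.Injective fμ)
    (hν : ∀ b : ν, ∃ α : Fin (d + 1), (fν b).2 = Sum.inl α) (hμ : ∀ a : μ, ∃ m : Fin (d + 1), (fμ a).2 = Sum.inr m)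
    (cb : ρ₁ → ν) (hcb : Function.Injective cb)
    (hlive : ∀ p : Idx M (Fib d),
      axEc ρ Lc p.1 p.1 p.2 p.2 = 1 ↔ (∃ b, b ∉ Set.range cb ∧ fν b = p) ∨ p ∈ Set.range fμ) (b b' : ν) :
    (kkt ((perF M Mh).submatrix fν fν)
      (fromRows ((perF M Mh).submatrix fμ fν)
        (Matrix.of fun (x : ρ₁) (b : ν) => if b = cb x then (1 : ℝ) else 0)))⁻¹ (Sum.inl b) (Sum.inl b')
      = if (b ∈ Set.range cb ∨ b' ∈ Set.range cb) then 0
        else perF M A (fν b) (fν b') := by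
  set Mp := perF M Mh with hMp
  by_cases hbc : b ∈ Set.range cb
  · obtain ⟨x, rfl⟩ := hbc
    rw [if_pos (Or.inl ⟨x, rfl⟩)]
    exact inv_kkt_kill_row _ _ cb (torus_isUnit_det_kkt_of_slots_of_relInv M ρ hM hA hMh hAt hMt hrel hmm hanti fν fμ hfν hfμ hν hμ cb hcb hlive) x _ (by simp)
  by_cases hbc' : b' ∈ Set.range cb
  · obtain ⟨x, rfl⟩ := hbc'
    rw [if_pos (Or.inr ⟨x, rfl⟩)]
    exact inv_kkt_kill_col _ _ cb (torus_isUnit_det_kkt_of_slots_of_relInv M ρ hM hA hMh hAt hMt hrel hmm hanti fν fμ hfν hfμ hν hμ cb hcb hlive) _ x (by simp)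
  rw [if_neg (not_or.2 ⟨hbc, hbc'⟩)]
  let f : {b : ν // b ∉ Set.range cb} ⊕ μ → Idx M (Fib d) := Sum.elim (fun b => fν b) fμ
  let g : ρ₁ → Idx M (Fib d) := fun x => fν (cb x)
  have hf : Function.Injective f := by
    rintro (b₁ | a₁) (b₂ | a₁') h
    · exact congrArg Sum.inl (Subtype.ext (hfν h))
    · obtain ⟨α, hα⟩ := hν b₁; obtain ⟨m, hm⟩ := hμ a₁'
      have e : (fν b₁).2 = (fμ a₁').2 := congrArg Prod.snd h; rw [hα, hm] at e; exact absurd e Sum.inl_ne_inr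
    · obtain ⟨α, hα⟩ := hν b₂; obtain ⟨m, hm⟩ := hμ a₁
      have e : (fμ a₁).2 = (fν b₂).2 := congrArg Prod.snd h; rw [hα, hm] at e; exact absurd e Sum.inr_ne_inl
    · exact congrArg Sum.inr (hfμ h)
  have hlive' : ∀ p : Idx M (Fib d), axEc ρ Lc p.1 p.1 p.2 p.2 = 1 ↔ p ∈ Set.range f := by
    intro p
    rw [hlive p]
    constructor
    · rintro (⟨b₁, hb, rfl⟩ | ⟨a₁, rfl⟩)
      exacts [⟨Sum.inl ⟨b₁, hb⟩, rfl⟩, ⟨Sum.inr a₁, rfl⟩]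
    · rintro ⟨b₁ | a₁, rfl⟩
      exacts [Or.inl ⟨b₁, b₁.2, rfl⟩, Or.inr ⟨a₁, rfl⟩]
  obtain ⟨-, hI⟩ := torus_sliced_kkt_of_relInv M ρ hM hA hMh hAt hMt hrel hmm hanti f hf hlive' (fun b => hν b) hμ g
  let eν : {b : ν // b ∉ Set.range cb} ⊕ ρ₁ ≃ ν :=
    ((Equiv.sumComm _ _).trans (Equiv.sumCongr (Equiv.ofInjective cb hcb) (Equiv.refl _))).trans (Equiv.sumCompl fun b => b ∈ Set.range cb)
  have heν_inl : ∀ b : {b : ν // b ∉ Set.range cb}, eν (Sum.inl b) = b := fun b => rfl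
  have heν_inr : ∀ x : ρ₁, eν (Sum.inr x) = cb x := fun x => rfl
  have hsys : kkt ((Mp.submatrix fν fν).submatrix eν eν)
        ((fromRows (Mp.submatrix fμ fν) (Matrix.of fun (x : ρ₁) (b : ν) => if b = cb x then (1 : ℝ) else 0)).submatrix id eν)
      = kkt (fromBlocks (Mp.submatrix (f ∘ Sum.inl) (f ∘ Sum.inl)) (Mp.submatrix (f ∘ Sum.inl) g) (Mp.submatrix g (f ∘ Sum.inl))
            (Mp.submatrix g g))
          (fromRows (fromCols (Mp.submatrix (f ∘ Sum.inr) (f ∘ Sum.inl)) (Mp.submatrix (f ∘ Sum.inr) g))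
            (fromCols (0 : Matrix ρ₁ {b : ν // b ∉ Set.range cb} ℝ) (1 : Matrix ρ₁ ρ₁ ℝ))) := by
    congr 1
    · ext (b₁ | x) (b₂ | x') <;> rfl
    · ext (a₁ | x) (b₂ | x') <;> try rfl
      · simp only [submatrix_apply, id, fromRows_apply_inr, fromCols_apply_inl, of_apply, heν_inl, Matrix.zero_apply]
        exact if_neg fun h : (b₂ : ν) = cb x => b₂.2 ⟨x, h.symm⟩
      · simp only [submatrix_apply, id, fromRows_apply_inr, fromCols_apply_inr, of_apply, heν_inr]
        by_cases h : x = x'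
        · subst h; rw [if_pos rfl, Matrix.one_apply_eq]
        · rw [if_neg fun e => h (hcb e).symm, Matrix.one_apply_ne h]
  have hb : (Sum.inl b : ν ⊕ (μ ⊕ ρ₁)) = Sum.map eν id (Sum.inl (Sum.inl ⟨b, hbc⟩)) := rfl
  have hb' : (Sum.inl b' : ν ⊕ (μ ⊕ ρ₁)) = Sum.map eν id (Sum.inl (Sum.inl ⟨b', hbc'⟩)) := rfl
  rw [hb, hb', inv_kkt_apply_reindex, hsys]
  have h := hI (Sum.inl ⟨b, hbc⟩) (Sum.inl ⟨b', hbc'⟩)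
  simp only [Sum.elim_inl, one_mul] at h
  exact h

end Slots

end Summit.QuantumFields.BalabanUV.Beta.FP.RelInvPeriodisedChartMinOp

end
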